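import Mathlib
import Literature.AlgebraicGeometry.Resolution.ValuedFunctionFieldsLemmas
import Literature.AlgebraicGeometry.Resolution.RegularCentreLocal
import Literature.AlgebraicGeometry.Resolution.CentreLocalRingLemmas
import Summits.ResolutionOfSingularities.ResolutionOfSingularities.Theorems.PAlterationPicoverLocalModelToLuAlphaPTorsor
import HarnessLib

/-!
# Crux `LogCanQuotLU` (stmt-ResolutionOfSingularities-17082), line `birth`:
# stub `stub_multiplicativeShrink` — a regular, `g • D`-stable basic open neighbourhood of the
# centre containing the eigenvalue and its inverse

Route `ResolutionOfSingularities/FoliationDescent`, crux #3 `LogCanQuotLU`, multiplicative half.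
This file proves the stub `Sig.stub_multiplicativeShrink` of the line `birth`
(`Cruxes/LogCanQuotLU/Lines/birth.lean`), verbatim: let `O` be a valuation ring of the field `K ⊇ k`,
`S' ≤ O` a finitely generated `k`-subalgebra, regular at the centre `𝔭 = 𝔪_O ∩ S'`, `D` a
`k`-derivation of `K` and `g ∈ K` such that `δ := g • D` preserves the local ring
`S'_𝔭 = {a / b | a, b ∈ S', |b| = 1}`, and suppose (multiplicative case) that `δ^[p] = u · δ` on
`K` for some `u ∈ S'_𝔭` with `u ≠ 0`, `u⁻¹ ∈ O`. Then there is a finitely generated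
`S' ≤ S'' ≤ O` which is a REGULAR RING (`IsRegularRing`: Noetherian and every localization at a
prime is a regular local ring), stable under `δ`, containing `u` and `u⁻¹` (and the same `u`
still satisfies `δ^[p] = u · δ`).

Proof (standard commutative algebra):
1. The regular locus of the finitely generated `k`-algebra `S'` is open
   (`Theorems.exists_isRegularRing_away_of_isRegularLocalRing`), so `S'[1/f₀]`
   (`Localization.Away f₀`) is a regular ring for some `f₀ ∈ S'` outside the centre, i.e. with
   `|f₀| = 1`.
2. Write `u = a / b` and `δ sᵢ = aᵢ / bᵢ` for a finite set of generators `sᵢ` of `S'`, with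
   `a, b, aᵢ, bᵢ ∈ S'` and `|b| = |bᵢ| = 1`; since `u⁻¹ ∈ O` also `|a| = 1`.
3. `f := f₀ a b ∏ bᵢ ∈ S'` has `|f| = 1`, and `S'' := S'[1/f] ⊆ K`
   (`Literature.AlgebraicGeometry.Resolution.locAway`) lies in `O`, is finitely generated, contains
   `a⁻¹, b⁻¹, bᵢ⁻¹` (divisors of `f`), hence `u^{±1}`.
4. `S'[1/f]` is the localization of `S'` at the submonoid generated by `f₀` and `f` (as `f₀ ∣ f`),
   hence a localization of the regular ring `S'[1/f₀]`, hence regular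
   (`Literature.AlgebraicGeometry.Resolution.isRegularRing_of_isLocalization`).
5. `δ`-stability: `{x ∈ S'' | δ x ∈ S''}` is a `k`-subalgebra containing the `sᵢ`
   (`δ sᵢ = aᵢ bᵢ⁻¹ ∈ S''`), hence `S'`, hence `f`, hence `f⁻¹` (`δ f⁻¹ = -f⁻² δ f`), hence
   `S'' = k[sᵢ, f⁻¹]`.

The hypotheses `p.Prime`, `CharP k p`, `IsFractionRing S' K` of the registered signature are idle
here. Helper facts live in the sub-namespace `MultiplicativeShrink`.
-/

set_option linter.dupNamespace false -- single-problem summit: doubled namespace component is forced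

noncomputable section

namespace Summit.ResolutionOfSingularities.ResolutionOfSingularities.Theorems

open IsLocalRing Literature.AlgebraicGeometry.Resolution

namespace MultiplicativeShrink

/-- An element `x` of a valuation ring `O` with `x ≠ 0` and `x⁻¹ ∈ O` is a unit of `O`: its value
is `1`. [folklore] -/
theorem valuation_eq_one_of_inv_mem {K : Type*} [Field K] (O : ValuationSubring K) {x : K}
    (hx : x ∈ O) (hx0 : x ≠ 0) (hxinv : x⁻¹ ∈ O) : O.valuation x = 1 := by
  have hx1 := (O.valuation_le_one_iff x).mpr hx
  have hy1 := (O.valuation_le_one_iff x⁻¹).mpr hxinv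
  refine le_antisymm hx1 ?_
  calc (1 : _) = O.valuation x * O.valuation x⁻¹ := by rw [← map_mul, mul_inv_cancel₀ hx0, map_one]
    _ ≤ O.valuation x * 1 := mul_le_mul_right hy1 _
    _ = O.valuation x := mul_one _

/-- If `c e = f` with `e ∈ B` and `c ≠ 0` then `c⁻¹ = e / f ∈ B[1/f]`. [folklore] -/
theorem inv_mem_locAway_of_mul_eq {R K : Type*} [CommRing R] [Field K] [Algebra R K]
    {B : Subalgebra R K} {f : K} {hf : f ∈ B} {c e : K} (hc0 : c ≠ 0) (he : e ∈ B)
    (hce : c * e = f) : c⁻¹ ∈ locAway B f hf := by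
  refine ⟨1, ?_⟩
  rw [pow_one, ← hce, ← mul_assoc, inv_mul_cancel₀ hc0, one_mul]
  exact he

/-- For a `k`-derivation `δ` of `K` and a `k`-subalgebra `W ≤ K`, the elements `x ∈ W` with
`δ x ∈ W` form a `k`-subalgebra (Leibniz rule; `δ` kills `k`). Stated as an existence with a
membership characterization. [folklore] -/
theorem exists_subalgebra_mem_iff_apply_mem {k K : Type*} [Field k] [Field K] [Algebra k K]
    (W : Subalgebra k K) (δ : Derivation k K K) :
    ∃ T : Subalgebra k K, ∀ x : K, x ∈ T ↔ (x ∈ W ∧ δ x ∈ W) := by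
  refine ⟨{ carrier := {x | x ∈ W ∧ δ x ∈ W}
            mul_mem' := ?_
            one_mem' := ⟨W.one_mem, by rw [Derivation.map_one_eq_zero]; exact W.zero_mem⟩
            add_mem' := ?_
            zero_mem' := ⟨W.zero_mem, by rw [map_zero]; exact W.zero_mem⟩
            algebraMap_mem' := fun c =>
              ⟨W.algebraMap_mem c, by rw [Derivation.map_algebraMap]; exact W.zero_mem⟩ },
          fun x => Iff.rfl⟩
  · rintro a b ⟨ha, hδa⟩ ⟨hb, hδb⟩
    refine ⟨W.mul_mem ha hb, ?_⟩
    rw [Derivation.leibniz, smul_eq_mul, smul_eq_mul]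
    exact W.add_mem (W.mul_mem ha hδb) (W.mul_mem hb hδa)
  · rintro a b ⟨ha, hδa⟩ ⟨hb, hδb⟩
    refine ⟨W.add_mem ha hb, ?_⟩
    rw [map_add]
    exact W.add_mem hδa hδb

/-- **Localizing further preserves regularity**: if `B` is a subalgebra of a field, `f₀ ∣ f` in
`B`, `f ≠ 0`, and the abstract localization `B[1/f₀]` is a regular ring, then the subalgebra
`B[1/f] ≤ K` (`locAway B f hf`) is a regular ring — it is the localization of `B` at the submonoid
generated by `f₀` and `f`, a localization of `B[1/f₀]`. [folklore] -/
theorem isRegularRing_locAway_of_dvd {k K : Type} [Field k] [Field K] [Algebra k K]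
    {B : Subalgebra k K} {f : K} {hf : f ∈ B} (hf0 : f ≠ 0) (f₀ : B) (hdvd : f₀ ∣ (⟨f, hf⟩ : B))
    (hreg : IsRegularRing (Localization.Away f₀)) : IsRegularRing (locAway B f hf) := by
  letI : Algebra B (locAway B f hf) :=
    (Subalgebra.inclusion (le_locAway (B := B) (f := f) (hf := hf))).toRingHom.toAlgebra
  haveI : IsLocalization.Away (⟨f, hf⟩ : B) (locAway B f hf) := isLocalization_locAway hf0
  let N : Submonoid B := Submonoid.powers f₀ ⊔ Submonoid.powers (⟨f, hf⟩ : B)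
  haveI hN : IsLocalization N (locAway B f hf) :=
    IsLocalization.of_le_of_exists_dvd (Submonoid.powers (⟨f, hf⟩ : B)) N le_sup_right (by
      intro n hn
      obtain ⟨y, hy, z, hz, rfl⟩ := Submonoid.mem_sup.mp hn
      obtain ⟨i, rfl⟩ := (Submonoid.mem_powers_iff _ _).mp hy
      obtain ⟨j, rfl⟩ := (Submonoid.mem_powers_iff _ _).mp hz
      refine ⟨(⟨f, hf⟩ : B) ^ (i + j), ⟨i + j, rfl⟩, ?_⟩
      rw [pow_add]
      exact mul_dvd_mul (pow_dvd_pow_of_dvd hdvd i) (dvd_refl _))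
  letI : Algebra (Localization.Away f₀) (locAway B f hf) :=
    IsLocalization.localizationAlgebraOfSubmonoidLe (Localization.Away f₀) (locAway B f hf)
      (Submonoid.powers f₀) N le_sup_left
  haveI : IsScalarTower B (Localization.Away f₀) (locAway B f hf) :=
    IsLocalization.localization_isScalarTower_of_submonoid_le (Localization.Away f₀)
      (locAway B f hf) (Submonoid.powers f₀) N le_sup_left
  haveI : IsLocalization (N.map (algebraMap B (Localization.Away f₀))) (locAway B f hf) :=
    IsLocalization.isLocalization_of_submonoid_le (Localization.Away f₀) (locAway B f hf)
      (Submonoid.powers f₀) N le_sup_left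
  haveI := hreg
  exact isRegularRing_of_isLocalization (A := Localization.Away f₀)
    (N.map (algebraMap B (Localization.Away f₀))) (locAway B f hf)

end MultiplicativeShrink

open MultiplicativeShrink

/-- **Stub `stub_multiplicativeShrink` of line `birth` of the crux `LogCanQuotLU`** (registered
signature, verbatim): in the multiplicative case (`(g • D)^[p] = u · (g • D)` with `u ∈ S'_𝔭`,
`u ≠ 0`, `u⁻¹ ∈ O`) of a finitely generated `S' ≤ O` regular at the centre `𝔭` of the valuation
ring `O`, with `g • D` preserving `S'_𝔭`, there is a finitely generated `S' ≤ S'' ≤ O` which is a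
regular ring, stable under `g • D`, and contains `u` and `u⁻¹`. (`S'' = S'[1/f]` for a suitable
`f ∈ S'` of value `1`; see the module docstring.) [folklore] -/
theorem stub_multiplicativeShrink :
  ∀ p : ℕ, p.Prime → ∀ (k K : Type) [Field k] [CharP k p] [Field K] [Algebra k K]
    (O : ValuationSubring K) (S' : Subalgebra k K) (h' : S'.toSubring ≤ O.toSubring)
    (D : Derivation k K K) (g : K),
    S'.FG → IsFractionRing S' K →
    IsRegularLocalRing
      (Localization.AtPrime (Ideal.comap (Subring.inclusion h') (IsLocalRing.maximalIdeal O))) →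
    (∀ x : K, (∃ a b : K, a ∈ S' ∧ b ∈ S' ∧ b ≠ 0 ∧ b⁻¹ ∈ O ∧ x = a / b) →
      ∃ a b : K, a ∈ S' ∧ b ∈ S' ∧ b ≠ 0 ∧ b⁻¹ ∈ O ∧ (g • D) x = a / b) →
    (∃ u : K, (∃ a b : K, a ∈ S' ∧ b ∈ S' ∧ b ≠ 0 ∧ b⁻¹ ∈ O ∧ u = a / b) ∧ u ≠ 0 ∧ u⁻¹ ∈ O ∧
      ∀ x : K, (⇑(g • D))^[p] x = u * (g • D) x) →
    ∃ (S'' : Subalgebra k K) (u : K), S' ≤ S'' ∧ S''.toSubring ≤ O.toSubring ∧ S''.FG ∧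
      IsRegularRing S'' ∧ (∀ x ∈ S'', (g • D) x ∈ S'') ∧ u ∈ S'' ∧ u⁻¹ ∈ S'' ∧ u ≠ 0 ∧
      ∀ x : K, (⇑(g • D))^[p] x = u * (g • D) x := by
  intro p _hp k K _ _ _ _ O S' h' D g hfg _hfrac hreg hpres hmu
  classical
  have hSO : ∀ x : K, x ∈ S' → x ∈ O := fun x hx => h' hx
  -- (1) a regular basic open neighbourhood `S'[1/f₀]` of the centre
  haveI : Algebra.FiniteType k S' := S'.fg_iff_finiteType.mp hfg
  obtain ⟨f₀, hf₀P, hf₀reg⟩ := exists_isRegularRing_away_of_isRegularLocalRing (k := k) (B := S')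
    (centreIdeal S' O h') hreg
  have hvf₀ : O.valuation (f₀ : K) = 1 := (not_mem_centreIdeal_iff S' h' f₀).mp hf₀P
  -- (2) the eigenvalue `u = a / b`, `|a| = |b| = 1`
  obtain ⟨u, ⟨a, b, ha, hb, hb0, hbinv, hu⟩, hu0, huinv, hmul⟩ := hmu
  have hvb : O.valuation b = 1 := valuation_eq_one_of_inv_mem O (hSO b hb) hb0 hbinv
  have huO : u ∈ O := by
    rw [hu, div_eq_mul_inv]
    exact mul_mem (hSO a ha) hbinv
  have hvu : O.valuation u = 1 := valuation_eq_one_of_inv_mem O huO hu0 huinv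
  have hva : O.valuation a = 1 := by
    have hab : a = u * b := by rw [hu, div_mul_cancel₀ a hb0]
    rw [hab, map_mul, hvu, hvb, mul_one]
  have ha0 : a ≠ 0 := ne_zero_of_valuation_eq_one hva
  -- generators `sᵢ` of `S'` and `(g • D) sᵢ = aᵢ / bᵢ`, `|bᵢ| = 1`
  obtain ⟨s, hs⟩ := hfg
  have hsS' : ∀ x ∈ s, x ∈ S' := fun x hx => hs ▸ Algebra.subset_adjoin hx
  have hgen : ∀ x ∈ s, ∃ a' b' : K, a' ∈ S' ∧ b' ∈ S' ∧ b' ≠ 0 ∧ b'⁻¹ ∈ O ∧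
      (g • D) x = a' / b' := fun x hx =>
    hpres x ⟨x, 1, hsS' x hx, S'.one_mem, one_ne_zero, by rw [inv_one]; exact one_mem O,
      (div_one x).symm⟩
  choose! na nb hna hnb hnb0 hnbinv hδs using hgen
  have hvnb : ∀ x ∈ s, O.valuation (nb x) = 1 := fun x hx =>
    valuation_eq_one_of_inv_mem O (hSO _ (hnb x hx)) (hnb0 x hx) (hnbinv x hx)
  obtain ⟨d, hddef⟩ : ∃ d : K, d = ∏ x ∈ s, nb x := ⟨_, rfl⟩
  have hd : d ∈ S' := hddef ▸ prod_mem fun x hx => hnb x hx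
  have hvd : O.valuation d = 1 := by
    rw [hddef, map_prod]
    exact Finset.prod_eq_one fun x hx => hvnb x hx
  -- (3) `f := f₀ a b ∏ bᵢ`, `S'' := S'[1/f]`
  obtain ⟨f, hfdef⟩ : ∃ f : K, f = (f₀ : K) * a * b * d := ⟨_, rfl⟩
  have hfS' : f ∈ S' := hfdef ▸ mul_mem (mul_mem (mul_mem f₀.2 ha) hb) hd
  have hvf : O.valuation f = 1 := by
    rw [hfdef, map_mul, map_mul, map_mul, hvf₀, hva, hvb, hvd, one_mul, one_mul, one_mul]
  have hf0 : f ≠ 0 := ne_zero_of_valuation_eq_one hvf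
  let S'' : Subalgebra k K := locAway S' f hfS'
  have hle : S' ≤ S'' := le_locAway
  have hfinv : f⁻¹ ∈ S'' := inv_mem_locAway hf0
  have hbinvS : b⁻¹ ∈ S'' :=
    inv_mem_locAway_of_mul_eq hb0 (mul_mem (mul_mem f₀.2 ha) hd) (by rw [hfdef]; ring)
  have hainvS : a⁻¹ ∈ S'' :=
    inv_mem_locAway_of_mul_eq ha0 (mul_mem (mul_mem f₀.2 hb) hd) (by rw [hfdef]; ring)
  have hnbinvS : ∀ x ∈ s, (nb x)⁻¹ ∈ S'' := fun x hx =>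
    inv_mem_locAway_of_mul_eq (hnb0 x hx)
      (mul_mem (mul_mem (mul_mem f₀.2 ha) hb)
        (prod_mem fun y hy => hnb y (Finset.mem_of_mem_erase hy)))
      (by rw [hfdef, hddef, ← Finset.mul_prod_erase s nb hx]; ring)
  -- (4) regularity of `S'[1/f]`, a localization of `S'[1/f₀]`
  have hdvd : f₀ ∣ (⟨f, hfS'⟩ : S') :=
    ⟨⟨a * b * d, mul_mem (mul_mem ha hb) hd⟩, Subtype.ext (by
      change f = (f₀ : K) * (a * b * d)
      rw [hfdef]; ring)⟩
  have hregS : IsRegularRing S'' := isRegularRing_locAway_of_dvd hf0 f₀ hdvd hf₀reg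
  -- (5) stability under `g • D`
  obtain ⟨T, hT⟩ := exists_subalgebra_mem_iff_apply_mem S'' (g • D)
  have hsT : (s : Set K) ⊆ T := fun x hx =>
    (hT x).mpr ⟨hle (hsS' x hx), by
      rw [hδs x hx, div_eq_mul_inv]
      exact mul_mem (hle (hna x hx)) (hnbinvS x hx)⟩
  have hS'T : S' ≤ T := by
    rw [← hs]
    exact Algebra.adjoin_le hsT
  have hδf : (g • D) f ∈ S'' := ((hT f).mp (hS'T hfS')).2
  have hfinvT : f⁻¹ ∈ T :=
    (hT _).mpr ⟨hfinv, by
      rw [Derivation.leibniz_inv, smul_eq_mul]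
      exact mul_mem (neg_mem (pow_mem hfinv 2)) hδf⟩
  have hS''T : S'' ≤ T :=
    (locAway_eq_adjoin hf0 hs).trans_le (Algebra.adjoin_le (Set.insert_subset hfinvT hsT))
  have hstab : ∀ x ∈ S'', (g • D) x ∈ S'' := fun x hx => ((hT x).mp (hS''T hx)).2
  -- (6) `u`, `u⁻¹ ∈ S''`
  have huS : u ∈ S'' := by
    rw [hu, div_eq_mul_inv]
    exact mul_mem (hle ha) hbinvS
  have huinvS : u⁻¹ ∈ S'' := by
    rw [hu, inv_div, div_eq_mul_inv]
    exact mul_mem (hle hb) hainvS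
  exact ⟨S'', u, hle, locAway_le_valuationSubring h' hvf, fg_locAway hf0 ⟨s, hs⟩, hregS, hstab,
    huS, huinvS, hu0, hmul⟩

end Summit.ResolutionOfSingularities.ResolutionOfSingularities.Theorems

end
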